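import Summits.BirchSwinnertonDyer.BirchSwinnertonDyer.Theorems.BiquadraticEisensteinDescentHeegnerTwistCouplingInSupplyKrizLiCornerQT27
import Summits.BirchSwinnertonDyer.BirchSwinnertonDyer.Theorems.PrintCFramJZeroThreeUnitRegimePrimePairInstances
import Literature.NumberTheory.QuadraticFields.ImaginaryQuadraticClassNumberValues
import HarnessLib

set_option linter.dupNamespace false -- `Summit.BirchSwinnertonDyer.BirchSwinnertonDyer.Theorems.…` (summit = sub, D-0017)
set_option autoImplicit false

/-!
# Crux `HeegnerTwistCouplingInSupply` (stmt-BirchSwinnertonDyer-21381) — QT27₊ through the Kriz–Li door, TABLE I: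
# every KL3-regular prime `q ≡ 5 (mod 12)` with 110 ≤ q < 400 — `q ∈ {149, 197, 233, 269, 293, 317, 389}`

Route `BiquadraticEisensteinDescent` (cell `pub/bsd-wall`, width seat `bsd-wall-cm-bed-w4` g27; `--supports` 21381, helper). Companion of
`…KrizLiCornerQT27.lean` (`exists_cruxConclusion_of_prime_pair`) / `…KrizLiCornerQT27Instances.lean` (q < 110). For each row ONE certificate prime `r ≡ 11 (mod 12)` with
`(−r/q) = +1`, `3 ∤ h(−qr)`, `h(−r) < q` (this seat's `work/py/qt27_rows2.py`), the two integer certificates `3 ∤ S₁(q,r)`, `3 ∥ S₂(q)` of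
Kriz–Li's Bernoulli hypothesis DECIDED in the kernel (Euler's criterion in `ℕ`, `RouteU.jacobiSym_prime_eq_ite_nat`; the largest sum here
has 17287 terms), and ★ `cruxOnQT27Plus_<q>`: the CONCLUSION of crux 21381 at `(W, q)` for every globally minimal
`W ≅ y² = x³ + q·m²` (bad primes `⊂ {3, q}`, `a₂ = 0` if good at `2`, `r_an(W) ≠ 0`) modulo the three named facts `hKL` (Kriz–Li 2019 Thm.
1.20), `hGZ` (Gross–Zagier), `hHP` (Heegner points). KL3-IRREGULAR `q ≡ 5 (12)` below `1000` (`3 ∣ h(−3q)`, corner void for this door):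
29, 113, 137, 173, 257, 281, 353, 401, 449, 461, 521, 653, 761, 773, 929, 953.

| `q` | `r` | `h(−r)` | terms of `S₁` |
|---|---|---|---|
| 149 | 47 | 5 | 7003 |
| 197 | 83 | 3 | 16351 |
| 233 | 71 | 7 | 16543 |
| 269 | 11 | 1 | 2959 |
| 293 | 59 | 3 | 17287 |
| 317 | 11 | 1 | 3487 |
| 389 | 11 | 1 | 4279 |

HONEST FRAMING: cells of ONE CM family; conditional on three REFEREED named facts; per-curve binders `hW`/`h6`/`h2`/`hS` displayed as in
the cell `bsd-print-cfram`'s class theorems; the crux (C⁺ / (S3′)(p) for all `p`), its registered stubs and BSD are NOT proved by any of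
this. THEOREMS ONLY. Supports stmt-BirchSwinnertonDyer-21381.
[cite: KrizLi2019, Thm. 1.20 (pp. 7–8), §1.5 (1)] [cite: Washington1997, Thm. 4.2] [cite: GrossZagier1986, Thm. I.(6.3), V.§1–2]
[cite: Cox2013, §2.A Thm. 2.13; §7.B Thm. 7.7(ii)] [cite: IrelandRosen1990, Prop. 5.1.2 (Euler's criterion)]
-/

noncomputable section

open scoped Classical

namespace Summit.BirchSwinnertonDyer.BirchSwinnertonDyer.Theorems.KrizLiCornerQT27

open _root_.WeierstrassCurve NumberField
open Literature.NumberTheory.EllipticCurves Literature.NumberTheory.EllipticCurves.KrizLi2019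
  Literature.NumberTheory.EllipticCurves.ModularForms Literature.NumberTheory.QuadraticFields
  Literature.NumberTheory.QuadraticFields.Quadratic
  Summit.BirchSwinnertonDyer.Rank1Residual.X12.O11.RouteU
  Summit.BirchSwinnertonDyer.BirchSwinnertonDyer.Theorems.PrintCFram

/-! ## `(q, r) = (149, 47)` -/

set_option maxRecDepth 800000 in
/-- **CERTIFICATES for `(q, r) = (149, 47)`**: `3 ∤ S₁(149,47)` (7003 terms), `3 ∣ S₂(149)`, `9 ∤ S₂(149)` (`decide +kernel` on Euler's criterion).
[cite: KrizLi2019, Thm. 1.20 (p. 8) and §1.5 (1)] [cite: Washington1997, Thm. 4.2] -/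
theorem cert_149_47 :
    ¬ ((3 : ℤ) ∣ ∑ j ∈ Finset.range (149 * 47), jacobiSym (j : ℤ) 149 * jacobiSym (j : ℤ) 47 * (j : ℤ)) ∧
    ((3 : ℤ) ∣ ∑ j ∈ Finset.range (149 * 3), jacobiSym (j : ℤ) 149 * jacobiSym (j : ℤ) 3 * (j : ℤ) ^ (0 + 1)) ∧
    ¬ ((3 : ℤ) ^ 2 ∣ ∑ j ∈ Finset.range (149 * 3), jacobiSym (j : ℤ) 149 * jacobiSym (j : ℤ) 3 * (j : ℤ) ^ (0 + 1)) := by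
  simp_rw [jacobiSym_prime_eq_ite_nat 149 (by norm_num) (by norm_num), jacobiSym_prime_eq_ite_nat 47 (by norm_num) (by norm_num),
    jacobiSym_prime_eq_ite_nat 3 (by norm_num) (by norm_num)]
  refine ⟨?_, ?_, ?_⟩ <;> decide +kernel

/-- ★ **The QT27₊ corner at `q = 149`** (certificate `r = 47`, `h(−47) = 5 < 149`): for every globally minimal `W ≅ y² = x³ + 149·m²`
(`149m²` sixth-power-free; `27a^{(149)}` is `m = 596`) with bad primes `⊂ {3, 149}`, `a₂(W) = 0` if good at `2`, `r_an(W) ≠ 0`: the CONCLUSION of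
crux 21381 at `(W, 149)`, modulo `hKL`, `hGZ`, `hHP` only. [cite: KrizLi2019, Thm. 1.20 (pp. 7–8)] [cite: GrossZagier1986, Thm. I.(6.3), V.§1–2] -/
theorem cruxOnQT27Plus_149 (hKL : thm120_padicLogHeegner_unit_of_bernoulli)
    (hGZ : ∀ (N : ℕ) [NeZero N] (W : WeierstrassCurve ℚ) (K : Type) [Field K] [NumberField K], gross_zagier N W K)
    (hHP : ∀ (W : WeierstrassCurve ℚ) (K : Type) [Field K] [NumberField K], exists_isHeegnerPoint W K)
    (W : WeierstrassCurve ℚ) [W.IsElliptic] [W.IsGloballyMinimal] [NeZero (W.conductorNorm ℤ)]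
    {m : ℤ} (hm : m ≠ 0) (hW : ∃ C : VariableChange ℚ, C • W = mordellCurve ((149 : ℚ) * (m : ℚ) ^ 2))
    (h6 : ∀ ℓ : ℕ, ℓ.Prime → ¬ ((ℓ : ℤ) ^ 6 ∣ (149 : ℤ) * m ^ 2))
    (h2 : (haveI : Fact (Nat.Prime 2) := ⟨Nat.prime_two⟩; W.HasGoodReductionAtPrime 2) → W.LFunction 2 = 0)
    (hS : ∀ ℓ : ℕ, (hℓ : ℓ.Prime) → ¬ (haveI := Fact.mk hℓ; W.HasGoodReductionAtPrime ℓ) → ℓ = 3 ∨ ℓ = 149)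
    (hr1 : W.analyticRank ≠ 0) :
    ∃ (K : Type) (_ : Field K) (_ : NumberField K),
      IsImaginaryQuadratic K ∧ 4 < (NumberField.discr K).natAbs ∧
      SatisfiesHeegnerHypothesis (W.conductorNorm ℤ) K ∧
      (W.quadraticTwist (NumberField.discr K : ℚ)).entireLFunction 1 ≠ 0 ∧ ¬ 149 ∣ NumberField.classNumber K := by
  haveI : Fact (Nat.Prime 149) := ⟨by norm_num⟩
  haveI : Fact (Nat.Prime 47) := ⟨by norm_num⟩
  exact exists_cruxConclusion_of_prime_pair hKL hGZ hHP (q := 149) (r := 47) (by norm_num) (by norm_num) (by norm_num)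
    (by norm_num) (by norm_num) (by norm_num)
    (by simp_rw [jacobiSym.legendreSym.to_jacobiSym]; exact cert_149_47.1)
    (by simp_rw [jacobiSym.legendreSym.to_jacobiSym]; exact cert_149_47.2.1)
    (by simp_rw [jacobiSym.legendreSym.to_jacobiSym]; exact cert_149_47.2.2)
    ClassNumberValues.classNumber_neg47 (by norm_num) W hm (by exact_mod_cast hW) (by exact_mod_cast h6) h2
    (fun ℓ hℓ hbad => (hS ℓ hℓ hbad).elim Or.inl fun h => Or.inr (Or.inl h)) hr1

/-! ## `(q, r) = (197, 83)` -/

set_option maxRecDepth 800000 in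
/-- **CERTIFICATES for `(q, r) = (197, 83)`**: `3 ∤ S₁(197,83)` (16351 terms), `3 ∣ S₂(197)`, `9 ∤ S₂(197)` (`decide +kernel` on Euler's criterion).
[cite: KrizLi2019, Thm. 1.20 (p. 8) and §1.5 (1)] [cite: Washington1997, Thm. 4.2] -/
theorem cert_197_83 :
    ¬ ((3 : ℤ) ∣ ∑ j ∈ Finset.range (197 * 83), jacobiSym (j : ℤ) 197 * jacobiSym (j : ℤ) 83 * (j : ℤ)) ∧
    ((3 : ℤ) ∣ ∑ j ∈ Finset.range (197 * 3), jacobiSym (j : ℤ) 197 * jacobiSym (j : ℤ) 3 * (j : ℤ) ^ (0 + 1)) ∧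
    ¬ ((3 : ℤ) ^ 2 ∣ ∑ j ∈ Finset.range (197 * 3), jacobiSym (j : ℤ) 197 * jacobiSym (j : ℤ) 3 * (j : ℤ) ^ (0 + 1)) := by
  simp_rw [jacobiSym_prime_eq_ite_nat 197 (by norm_num) (by norm_num), jacobiSym_prime_eq_ite_nat 83 (by norm_num) (by norm_num),
    jacobiSym_prime_eq_ite_nat 3 (by norm_num) (by norm_num)]
  refine ⟨?_, ?_, ?_⟩ <;> decide +kernel

/-- ★ **The QT27₊ corner at `q = 197`** (certificate `r = 83`, `h(−83) = 3 < 197`): for every globally minimal `W ≅ y² = x³ + 197·m²`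
(`197m²` sixth-power-free; `27a^{(197)}` is `m = 788`) with bad primes `⊂ {3, 197}`, `a₂(W) = 0` if good at `2`, `r_an(W) ≠ 0`: the CONCLUSION of
crux 21381 at `(W, 197)`, modulo `hKL`, `hGZ`, `hHP` only. [cite: KrizLi2019, Thm. 1.20 (pp. 7–8)] [cite: GrossZagier1986, Thm. I.(6.3), V.§1–2] -/
theorem cruxOnQT27Plus_197 (hKL : thm120_padicLogHeegner_unit_of_bernoulli)
    (hGZ : ∀ (N : ℕ) [NeZero N] (W : WeierstrassCurve ℚ) (K : Type) [Field K] [NumberField K], gross_zagier N W K)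
    (hHP : ∀ (W : WeierstrassCurve ℚ) (K : Type) [Field K] [NumberField K], exists_isHeegnerPoint W K)
    (W : WeierstrassCurve ℚ) [W.IsElliptic] [W.IsGloballyMinimal] [NeZero (W.conductorNorm ℤ)]
    {m : ℤ} (hm : m ≠ 0) (hW : ∃ C : VariableChange ℚ, C • W = mordellCurve ((197 : ℚ) * (m : ℚ) ^ 2))
    (h6 : ∀ ℓ : ℕ, ℓ.Prime → ¬ ((ℓ : ℤ) ^ 6 ∣ (197 : ℤ) * m ^ 2))
    (h2 : (haveI : Fact (Nat.Prime 2) := ⟨Nat.prime_two⟩; W.HasGoodReductionAtPrime 2) → W.LFunction 2 = 0)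
    (hS : ∀ ℓ : ℕ, (hℓ : ℓ.Prime) → ¬ (haveI := Fact.mk hℓ; W.HasGoodReductionAtPrime ℓ) → ℓ = 3 ∨ ℓ = 197)
    (hr1 : W.analyticRank ≠ 0) :
    ∃ (K : Type) (_ : Field K) (_ : NumberField K),
      IsImaginaryQuadratic K ∧ 4 < (NumberField.discr K).natAbs ∧
      SatisfiesHeegnerHypothesis (W.conductorNorm ℤ) K ∧
      (W.quadraticTwist (NumberField.discr K : ℚ)).entireLFunction 1 ≠ 0 ∧ ¬ 197 ∣ NumberField.classNumber K := by
  haveI : Fact (Nat.Prime 197) := ⟨by norm_num⟩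
  haveI : Fact (Nat.Prime 83) := ⟨by norm_num⟩
  exact exists_cruxConclusion_of_prime_pair hKL hGZ hHP (q := 197) (r := 83) (by norm_num) (by norm_num) (by norm_num)
    (by norm_num) (by norm_num) (by norm_num)
    (by simp_rw [jacobiSym.legendreSym.to_jacobiSym]; exact cert_197_83.1)
    (by simp_rw [jacobiSym.legendreSym.to_jacobiSym]; exact cert_197_83.2.1)
    (by simp_rw [jacobiSym.legendreSym.to_jacobiSym]; exact cert_197_83.2.2)
    ClassNumberValues.classNumber_neg83 (by norm_num) W hm (by exact_mod_cast hW) (by exact_mod_cast h6) h2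
    (fun ℓ hℓ hbad => (hS ℓ hℓ hbad).elim Or.inl fun h => Or.inr (Or.inl h)) hr1

/-! ## `(q, r) = (233, 71)` -/

set_option maxRecDepth 800000 in
/-- **CERTIFICATES for `(q, r) = (233, 71)`**: `3 ∤ S₁(233,71)` (16543 terms), `3 ∣ S₂(233)`, `9 ∤ S₂(233)` (`decide +kernel` on Euler's criterion).
[cite: KrizLi2019, Thm. 1.20 (p. 8) and §1.5 (1)] [cite: Washington1997, Thm. 4.2] -/
theorem cert_233_71 :
    ¬ ((3 : ℤ) ∣ ∑ j ∈ Finset.range (233 * 71), jacobiSym (j : ℤ) 233 * jacobiSym (j : ℤ) 71 * (j : ℤ)) ∧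
    ((3 : ℤ) ∣ ∑ j ∈ Finset.range (233 * 3), jacobiSym (j : ℤ) 233 * jacobiSym (j : ℤ) 3 * (j : ℤ) ^ (0 + 1)) ∧
    ¬ ((3 : ℤ) ^ 2 ∣ ∑ j ∈ Finset.range (233 * 3), jacobiSym (j : ℤ) 233 * jacobiSym (j : ℤ) 3 * (j : ℤ) ^ (0 + 1)) := by
  simp_rw [jacobiSym_prime_eq_ite_nat 233 (by norm_num) (by norm_num), jacobiSym_prime_eq_ite_nat 71 (by norm_num) (by norm_num),
    jacobiSym_prime_eq_ite_nat 3 (by norm_num) (by norm_num)]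
  refine ⟨?_, ?_, ?_⟩ <;> decide +kernel

/-- ★ **The QT27₊ corner at `q = 233`** (certificate `r = 71`, `h(−71) = 7 < 233`): for every globally minimal `W ≅ y² = x³ + 233·m²`
(`233m²` sixth-power-free; `27a^{(233)}` is `m = 932`) with bad primes `⊂ {3, 233}`, `a₂(W) = 0` if good at `2`, `r_an(W) ≠ 0`: the CONCLUSION of
crux 21381 at `(W, 233)`, modulo `hKL`, `hGZ`, `hHP` only. [cite: KrizLi2019, Thm. 1.20 (pp. 7–8)] [cite: GrossZagier1986, Thm. I.(6.3), V.§1–2] -/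
theorem cruxOnQT27Plus_233 (hKL : thm120_padicLogHeegner_unit_of_bernoulli)
    (hGZ : ∀ (N : ℕ) [NeZero N] (W : WeierstrassCurve ℚ) (K : Type) [Field K] [NumberField K], gross_zagier N W K)
    (hHP : ∀ (W : WeierstrassCurve ℚ) (K : Type) [Field K] [NumberField K], exists_isHeegnerPoint W K)
    (W : WeierstrassCurve ℚ) [W.IsElliptic] [W.IsGloballyMinimal] [NeZero (W.conductorNorm ℤ)]
    {m : ℤ} (hm : m ≠ 0) (hW : ∃ C : VariableChange ℚ, C • W = mordellCurve ((233 : ℚ) * (m : ℚ) ^ 2))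
    (h6 : ∀ ℓ : ℕ, ℓ.Prime → ¬ ((ℓ : ℤ) ^ 6 ∣ (233 : ℤ) * m ^ 2))
    (h2 : (haveI : Fact (Nat.Prime 2) := ⟨Nat.prime_two⟩; W.HasGoodReductionAtPrime 2) → W.LFunction 2 = 0)
    (hS : ∀ ℓ : ℕ, (hℓ : ℓ.Prime) → ¬ (haveI := Fact.mk hℓ; W.HasGoodReductionAtPrime ℓ) → ℓ = 3 ∨ ℓ = 233)
    (hr1 : W.analyticRank ≠ 0) :
    ∃ (K : Type) (_ : Field K) (_ : NumberField K),
      IsImaginaryQuadratic K ∧ 4 < (NumberField.discr K).natAbs ∧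
      SatisfiesHeegnerHypothesis (W.conductorNorm ℤ) K ∧
      (W.quadraticTwist (NumberField.discr K : ℚ)).entireLFunction 1 ≠ 0 ∧ ¬ 233 ∣ NumberField.classNumber K := by
  haveI : Fact (Nat.Prime 233) := ⟨by norm_num⟩
  haveI : Fact (Nat.Prime 71) := ⟨by norm_num⟩
  exact exists_cruxConclusion_of_prime_pair hKL hGZ hHP (q := 233) (r := 71) (by norm_num) (by norm_num) (by norm_num)
    (by norm_num) (by norm_num) (by norm_num)
    (by simp_rw [jacobiSym.legendreSym.to_jacobiSym]; exact cert_233_71.1)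
    (by simp_rw [jacobiSym.legendreSym.to_jacobiSym]; exact cert_233_71.2.1)
    (by simp_rw [jacobiSym.legendreSym.to_jacobiSym]; exact cert_233_71.2.2)
    ClassNumberValues.classNumber_neg71 (by norm_num) W hm (by exact_mod_cast hW) (by exact_mod_cast h6) h2
    (fun ℓ hℓ hbad => (hS ℓ hℓ hbad).elim Or.inl fun h => Or.inr (Or.inl h)) hr1

/-! ## `(q, r) = (269, 11)` -/

set_option maxRecDepth 800000 in
/-- **CERTIFICATES for `(q, r) = (269, 11)`**: `3 ∤ S₁(269,11)` (2959 terms), `3 ∣ S₂(269)`, `9 ∤ S₂(269)` (`decide +kernel` on Euler's criterion).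
[cite: KrizLi2019, Thm. 1.20 (p. 8) and §1.5 (1)] [cite: Washington1997, Thm. 4.2] -/
theorem cert_269_11 :
    ¬ ((3 : ℤ) ∣ ∑ j ∈ Finset.range (269 * 11), jacobiSym (j : ℤ) 269 * jacobiSym (j : ℤ) 11 * (j : ℤ)) ∧
    ((3 : ℤ) ∣ ∑ j ∈ Finset.range (269 * 3), jacobiSym (j : ℤ) 269 * jacobiSym (j : ℤ) 3 * (j : ℤ) ^ (0 + 1)) ∧
    ¬ ((3 : ℤ) ^ 2 ∣ ∑ j ∈ Finset.range (269 * 3), jacobiSym (j : ℤ) 269 * jacobiSym (j : ℤ) 3 * (j : ℤ) ^ (0 + 1)) := by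
  simp_rw [jacobiSym_prime_eq_ite_nat 269 (by norm_num) (by norm_num), jacobiSym_prime_eq_ite_nat 11 (by norm_num) (by norm_num),
    jacobiSym_prime_eq_ite_nat 3 (by norm_num) (by norm_num)]
  refine ⟨?_, ?_, ?_⟩ <;> decide +kernel

/-- ★ **The QT27₊ corner at `q = 269`** (certificate `r = 11`, `h(−11) = 1 < 269`): for every globally minimal `W ≅ y² = x³ + 269·m²`
(`269m²` sixth-power-free; `27a^{(269)}` is `m = 1076`) with bad primes `⊂ {3, 269}`, `a₂(W) = 0` if good at `2`, `r_an(W) ≠ 0`: the CONCLUSION of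
crux 21381 at `(W, 269)`, modulo `hKL`, `hGZ`, `hHP` only. [cite: KrizLi2019, Thm. 1.20 (pp. 7–8)] [cite: GrossZagier1986, Thm. I.(6.3), V.§1–2] -/
theorem cruxOnQT27Plus_269 (hKL : thm120_padicLogHeegner_unit_of_bernoulli)
    (hGZ : ∀ (N : ℕ) [NeZero N] (W : WeierstrassCurve ℚ) (K : Type) [Field K] [NumberField K], gross_zagier N W K)
    (hHP : ∀ (W : WeierstrassCurve ℚ) (K : Type) [Field K] [NumberField K], exists_isHeegnerPoint W K)
    (W : WeierstrassCurve ℚ) [W.IsElliptic] [W.IsGloballyMinimal] [NeZero (W.conductorNorm ℤ)]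
    {m : ℤ} (hm : m ≠ 0) (hW : ∃ C : VariableChange ℚ, C • W = mordellCurve ((269 : ℚ) * (m : ℚ) ^ 2))
    (h6 : ∀ ℓ : ℕ, ℓ.Prime → ¬ ((ℓ : ℤ) ^ 6 ∣ (269 : ℤ) * m ^ 2))
    (h2 : (haveI : Fact (Nat.Prime 2) := ⟨Nat.prime_two⟩; W.HasGoodReductionAtPrime 2) → W.LFunction 2 = 0)
    (hS : ∀ ℓ : ℕ, (hℓ : ℓ.Prime) → ¬ (haveI := Fact.mk hℓ; W.HasGoodReductionAtPrime ℓ) → ℓ = 3 ∨ ℓ = 269)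
    (hr1 : W.analyticRank ≠ 0) :
    ∃ (K : Type) (_ : Field K) (_ : NumberField K),
      IsImaginaryQuadratic K ∧ 4 < (NumberField.discr K).natAbs ∧
      SatisfiesHeegnerHypothesis (W.conductorNorm ℤ) K ∧
      (W.quadraticTwist (NumberField.discr K : ℚ)).entireLFunction 1 ≠ 0 ∧ ¬ 269 ∣ NumberField.classNumber K := by
  haveI : Fact (Nat.Prime 269) := ⟨by norm_num⟩
  haveI : Fact (Nat.Prime 11) := ⟨by norm_num⟩
  exact exists_cruxConclusion_of_prime_pair hKL hGZ hHP (q := 269) (r := 11) (by norm_num) (by norm_num) (by norm_num)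
    (by norm_num) (by norm_num) (by norm_num)
    (by simp_rw [jacobiSym.legendreSym.to_jacobiSym]; exact cert_269_11.1)
    (by simp_rw [jacobiSym.legendreSym.to_jacobiSym]; exact cert_269_11.2.1)
    (by simp_rw [jacobiSym.legendreSym.to_jacobiSym]; exact cert_269_11.2.2)
    ClassNumberValues.classNumber_neg11 (by norm_num) W hm (by exact_mod_cast hW) (by exact_mod_cast h6) h2
    (fun ℓ hℓ hbad => (hS ℓ hℓ hbad).elim Or.inl fun h => Or.inr (Or.inl h)) hr1

/-! ## `(q, r) = (293, 59)` -/

set_option maxRecDepth 800000 in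
/-- **CERTIFICATES for `(q, r) = (293, 59)`**: `3 ∤ S₁(293,59)` (17287 terms), `3 ∣ S₂(293)`, `9 ∤ S₂(293)` (`decide +kernel` on Euler's criterion).
[cite: KrizLi2019, Thm. 1.20 (p. 8) and §1.5 (1)] [cite: Washington1997, Thm. 4.2] -/
theorem cert_293_59 :
    ¬ ((3 : ℤ) ∣ ∑ j ∈ Finset.range (293 * 59), jacobiSym (j : ℤ) 293 * jacobiSym (j : ℤ) 59 * (j : ℤ)) ∧
    ((3 : ℤ) ∣ ∑ j ∈ Finset.range (293 * 3), jacobiSym (j : ℤ) 293 * jacobiSym (j : ℤ) 3 * (j : ℤ) ^ (0 + 1)) ∧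
    ¬ ((3 : ℤ) ^ 2 ∣ ∑ j ∈ Finset.range (293 * 3), jacobiSym (j : ℤ) 293 * jacobiSym (j : ℤ) 3 * (j : ℤ) ^ (0 + 1)) := by
  simp_rw [jacobiSym_prime_eq_ite_nat 293 (by norm_num) (by norm_num), jacobiSym_prime_eq_ite_nat 59 (by norm_num) (by norm_num),
    jacobiSym_prime_eq_ite_nat 3 (by norm_num) (by norm_num)]
  refine ⟨?_, ?_, ?_⟩ <;> decide +kernel

/-- ★ **The QT27₊ corner at `q = 293`** (certificate `r = 59`, `h(−59) = 3 < 293`): for every globally minimal `W ≅ y² = x³ + 293·m²`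
(`293m²` sixth-power-free; `27a^{(293)}` is `m = 1172`) with bad primes `⊂ {3, 293}`, `a₂(W) = 0` if good at `2`, `r_an(W) ≠ 0`: the CONCLUSION of
crux 21381 at `(W, 293)`, modulo `hKL`, `hGZ`, `hHP` only. [cite: KrizLi2019, Thm. 1.20 (pp. 7–8)] [cite: GrossZagier1986, Thm. I.(6.3), V.§1–2] -/
theorem cruxOnQT27Plus_293 (hKL : thm120_padicLogHeegner_unit_of_bernoulli)
    (hGZ : ∀ (N : ℕ) [NeZero N] (W : WeierstrassCurve ℚ) (K : Type) [Field K] [NumberField K], gross_zagier N W K)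
    (hHP : ∀ (W : WeierstrassCurve ℚ) (K : Type) [Field K] [NumberField K], exists_isHeegnerPoint W K)
    (W : WeierstrassCurve ℚ) [W.IsElliptic] [W.IsGloballyMinimal] [NeZero (W.conductorNorm ℤ)]
    {m : ℤ} (hm : m ≠ 0) (hW : ∃ C : VariableChange ℚ, C • W = mordellCurve ((293 : ℚ) * (m : ℚ) ^ 2))
    (h6 : ∀ ℓ : ℕ, ℓ.Prime → ¬ ((ℓ : ℤ) ^ 6 ∣ (293 : ℤ) * m ^ 2))
    (h2 : (haveI : Fact (Nat.Prime 2) := ⟨Nat.prime_two⟩; W.HasGoodReductionAtPrime 2) → W.LFunction 2 = 0)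
    (hS : ∀ ℓ : ℕ, (hℓ : ℓ.Prime) → ¬ (haveI := Fact.mk hℓ; W.HasGoodReductionAtPrime ℓ) → ℓ = 3 ∨ ℓ = 293)
    (hr1 : W.analyticRank ≠ 0) :
    ∃ (K : Type) (_ : Field K) (_ : NumberField K),
      IsImaginaryQuadratic K ∧ 4 < (NumberField.discr K).natAbs ∧
      SatisfiesHeegnerHypothesis (W.conductorNorm ℤ) K ∧
      (W.quadraticTwist (NumberField.discr K : ℚ)).entireLFunction 1 ≠ 0 ∧ ¬ 293 ∣ NumberField.classNumber K := by
  haveI : Fact (Nat.Prime 293) := ⟨by norm_num⟩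
  haveI : Fact (Nat.Prime 59) := ⟨by norm_num⟩
  exact exists_cruxConclusion_of_prime_pair hKL hGZ hHP (q := 293) (r := 59) (by norm_num) (by norm_num) (by norm_num)
    (by norm_num) (by norm_num) (by norm_num)
    (by simp_rw [jacobiSym.legendreSym.to_jacobiSym]; exact cert_293_59.1)
    (by simp_rw [jacobiSym.legendreSym.to_jacobiSym]; exact cert_293_59.2.1)
    (by simp_rw [jacobiSym.legendreSym.to_jacobiSym]; exact cert_293_59.2.2)
    ClassNumberValues.classNumber_neg59 (by norm_num) W hm (by exact_mod_cast hW) (by exact_mod_cast h6) h2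
    (fun ℓ hℓ hbad => (hS ℓ hℓ hbad).elim Or.inl fun h => Or.inr (Or.inl h)) hr1

/-! ## `(q, r) = (317, 11)` -/

set_option maxRecDepth 800000 in
/-- **CERTIFICATES for `(q, r) = (317, 11)`**: `3 ∤ S₁(317,11)` (3487 terms), `3 ∣ S₂(317)`, `9 ∤ S₂(317)` (`decide +kernel` on Euler's criterion).
[cite: KrizLi2019, Thm. 1.20 (p. 8) and §1.5 (1)] [cite: Washington1997, Thm. 4.2] -/
theorem cert_317_11 :
    ¬ ((3 : ℤ) ∣ ∑ j ∈ Finset.range (317 * 11), jacobiSym (j : ℤ) 317 * jacobiSym (j : ℤ) 11 * (j : ℤ)) ∧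
    ((3 : ℤ) ∣ ∑ j ∈ Finset.range (317 * 3), jacobiSym (j : ℤ) 317 * jacobiSym (j : ℤ) 3 * (j : ℤ) ^ (0 + 1)) ∧
    ¬ ((3 : ℤ) ^ 2 ∣ ∑ j ∈ Finset.range (317 * 3), jacobiSym (j : ℤ) 317 * jacobiSym (j : ℤ) 3 * (j : ℤ) ^ (0 + 1)) := by
  simp_rw [jacobiSym_prime_eq_ite_nat 317 (by norm_num) (by norm_num), jacobiSym_prime_eq_ite_nat 11 (by norm_num) (by norm_num),
    jacobiSym_prime_eq_ite_nat 3 (by norm_num) (by norm_num)]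
  refine ⟨?_, ?_, ?_⟩ <;> decide +kernel

/-- ★ **The QT27₊ corner at `q = 317`** (certificate `r = 11`, `h(−11) = 1 < 317`): for every globally minimal `W ≅ y² = x³ + 317·m²`
(`317m²` sixth-power-free; `27a^{(317)}` is `m = 1268`) with bad primes `⊂ {3, 317}`, `a₂(W) = 0` if good at `2`, `r_an(W) ≠ 0`: the CONCLUSION of
crux 21381 at `(W, 317)`, modulo `hKL`, `hGZ`, `hHP` only. [cite: KrizLi2019, Thm. 1.20 (pp. 7–8)] [cite: GrossZagier1986, Thm. I.(6.3), V.§1–2] -/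
theorem cruxOnQT27Plus_317 (hKL : thm120_padicLogHeegner_unit_of_bernoulli)
    (hGZ : ∀ (N : ℕ) [NeZero N] (W : WeierstrassCurve ℚ) (K : Type) [Field K] [NumberField K], gross_zagier N W K)
    (hHP : ∀ (W : WeierstrassCurve ℚ) (K : Type) [Field K] [NumberField K], exists_isHeegnerPoint W K)
    (W : WeierstrassCurve ℚ) [W.IsElliptic] [W.IsGloballyMinimal] [NeZero (W.conductorNorm ℤ)]
    {m : ℤ} (hm : m ≠ 0) (hW : ∃ C : VariableChange ℚ, C • W = mordellCurve ((317 : ℚ) * (m : ℚ) ^ 2))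
    (h6 : ∀ ℓ : ℕ, ℓ.Prime → ¬ ((ℓ : ℤ) ^ 6 ∣ (317 : ℤ) * m ^ 2))
    (h2 : (haveI : Fact (Nat.Prime 2) := ⟨Nat.prime_two⟩; W.HasGoodReductionAtPrime 2) → W.LFunction 2 = 0)
    (hS : ∀ ℓ : ℕ, (hℓ : ℓ.Prime) → ¬ (haveI := Fact.mk hℓ; W.HasGoodReductionAtPrime ℓ) → ℓ = 3 ∨ ℓ = 317)
    (hr1 : W.analyticRank ≠ 0) :
    ∃ (K : Type) (_ : Field K) (_ : NumberField K),
      IsImaginaryQuadratic K ∧ 4 < (NumberField.discr K).natAbs ∧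
      SatisfiesHeegnerHypothesis (W.conductorNorm ℤ) K ∧
      (W.quadraticTwist (NumberField.discr K : ℚ)).entireLFunction 1 ≠ 0 ∧ ¬ 317 ∣ NumberField.classNumber K := by
  haveI : Fact (Nat.Prime 317) := ⟨by norm_num⟩
  haveI : Fact (Nat.Prime 11) := ⟨by norm_num⟩
  exact exists_cruxConclusion_of_prime_pair hKL hGZ hHP (q := 317) (r := 11) (by norm_num) (by norm_num) (by norm_num)
    (by norm_num) (by norm_num) (by norm_num)
    (by simp_rw [jacobiSym.legendreSym.to_jacobiSym]; exact cert_317_11.1)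
    (by simp_rw [jacobiSym.legendreSym.to_jacobiSym]; exact cert_317_11.2.1)
    (by simp_rw [jacobiSym.legendreSym.to_jacobiSym]; exact cert_317_11.2.2)
    ClassNumberValues.classNumber_neg11 (by norm_num) W hm (by exact_mod_cast hW) (by exact_mod_cast h6) h2
    (fun ℓ hℓ hbad => (hS ℓ hℓ hbad).elim Or.inl fun h => Or.inr (Or.inl h)) hr1

/-! ## `(q, r) = (389, 11)` -/

set_option maxRecDepth 800000 in
/-- **CERTIFICATES for `(q, r) = (389, 11)`**: `3 ∤ S₁(389,11)` (4279 terms), `3 ∣ S₂(389)`, `9 ∤ S₂(389)` (`decide +kernel` on Euler's criterion).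
[cite: KrizLi2019, Thm. 1.20 (p. 8) and §1.5 (1)] [cite: Washington1997, Thm. 4.2] -/
theorem cert_389_11 :
    ¬ ((3 : ℤ) ∣ ∑ j ∈ Finset.range (389 * 11), jacobiSym (j : ℤ) 389 * jacobiSym (j : ℤ) 11 * (j : ℤ)) ∧
    ((3 : ℤ) ∣ ∑ j ∈ Finset.range (389 * 3), jacobiSym (j : ℤ) 389 * jacobiSym (j : ℤ) 3 * (j : ℤ) ^ (0 + 1)) ∧
    ¬ ((3 : ℤ) ^ 2 ∣ ∑ j ∈ Finset.range (389 * 3), jacobiSym (j : ℤ) 389 * jacobiSym (j : ℤ) 3 * (j : ℤ) ^ (0 + 1)) := by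
  simp_rw [jacobiSym_prime_eq_ite_nat 389 (by norm_num) (by norm_num), jacobiSym_prime_eq_ite_nat 11 (by norm_num) (by norm_num),
    jacobiSym_prime_eq_ite_nat 3 (by norm_num) (by norm_num)]
  refine ⟨?_, ?_, ?_⟩ <;> decide +kernel

/-- ★ **The QT27₊ corner at `q = 389`** (certificate `r = 11`, `h(−11) = 1 < 389`): for every globally minimal `W ≅ y² = x³ + 389·m²`
(`389m²` sixth-power-free; `27a^{(389)}` is `m = 1556`) with bad primes `⊂ {3, 389}`, `a₂(W) = 0` if good at `2`, `r_an(W) ≠ 0`: the CONCLUSION of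
crux 21381 at `(W, 389)`, modulo `hKL`, `hGZ`, `hHP` only. [cite: KrizLi2019, Thm. 1.20 (pp. 7–8)] [cite: GrossZagier1986, Thm. I.(6.3), V.§1–2] -/
theorem cruxOnQT27Plus_389 (hKL : thm120_padicLogHeegner_unit_of_bernoulli)
    (hGZ : ∀ (N : ℕ) [NeZero N] (W : WeierstrassCurve ℚ) (K : Type) [Field K] [NumberField K], gross_zagier N W K)
    (hHP : ∀ (W : WeierstrassCurve ℚ) (K : Type) [Field K] [NumberField K], exists_isHeegnerPoint W K)
    (W : WeierstrassCurve ℚ) [W.IsElliptic] [W.IsGloballyMinimal] [NeZero (W.conductorNorm ℤ)]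
    {m : ℤ} (hm : m ≠ 0) (hW : ∃ C : VariableChange ℚ, C • W = mordellCurve ((389 : ℚ) * (m : ℚ) ^ 2))
    (h6 : ∀ ℓ : ℕ, ℓ.Prime → ¬ ((ℓ : ℤ) ^ 6 ∣ (389 : ℤ) * m ^ 2))
    (h2 : (haveI : Fact (Nat.Prime 2) := ⟨Nat.prime_two⟩; W.HasGoodReductionAtPrime 2) → W.LFunction 2 = 0)
    (hS : ∀ ℓ : ℕ, (hℓ : ℓ.Prime) → ¬ (haveI := Fact.mk hℓ; W.HasGoodReductionAtPrime ℓ) → ℓ = 3 ∨ ℓ = 389)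
    (hr1 : W.analyticRank ≠ 0) :
    ∃ (K : Type) (_ : Field K) (_ : NumberField K),
      IsImaginaryQuadratic K ∧ 4 < (NumberField.discr K).natAbs ∧
      SatisfiesHeegnerHypothesis (W.conductorNorm ℤ) K ∧
      (W.quadraticTwist (NumberField.discr K : ℚ)).entireLFunction 1 ≠ 0 ∧ ¬ 389 ∣ NumberField.classNumber K := by
  haveI : Fact (Nat.Prime 389) := ⟨by norm_num⟩
  haveI : Fact (Nat.Prime 11) := ⟨by norm_num⟩
  exact exists_cruxConclusion_of_prime_pair hKL hGZ hHP (q := 389) (r := 11) (by norm_num) (by norm_num) (by norm_num)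
    (by norm_num) (by norm_num) (by norm_num)
    (by simp_rw [jacobiSym.legendreSym.to_jacobiSym]; exact cert_389_11.1)
    (by simp_rw [jacobiSym.legendreSym.to_jacobiSym]; exact cert_389_11.2.1)
    (by simp_rw [jacobiSym.legendreSym.to_jacobiSym]; exact cert_389_11.2.2)
    ClassNumberValues.classNumber_neg11 (by norm_num) W hm (by exact_mod_cast hW) (by exact_mod_cast h6) h2
    (fun ℓ hℓ hbad => (hS ℓ hℓ hbad).elim Or.inl fun h => Or.inr (Or.inl h)) hr1

end Summit.BirchSwinnertonDyer.BirchSwinnertonDyer.Theorems.KrizLiCornerQT27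

end
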